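import Literature.NumberTheory.PAdicHodge.BdRPlusLogLatticeZp
import HarnessLib

/-!
# `X⁰_k = log[1 + p♭𝒪♭] mod Fil^k`: the `ℤ_p[Γ_F]`-module of Teichmüller logarithms, `0 → ℚ_p·t → ℚ_p X⁰_k → ℂ_F → 0`

Topic `Literature/NumberTheory/PAdicHodge`; namespace `Literature.NumberTheory.PAdicHodge.GaloisContinuity`. One definition (reviewed): the
predicate `IsTeichLog k L` — «`L ∈ B_dR⁺` is a logarithm modulo `Fil^k` of a Teichmüller representative `[x]`, `x ∈ 𝒪_{ℂ_F}♭`, `x₀ = 1`»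
(`∃ x, PreTilt.coeff 0 x = 1 ∧ IsLogModFil k ([x] − 1) L`) — and the INTERFACE of the five files `BdRPlusLogLattice{,Mul,Theta,Kernel,Zp}`
in this currency (no new mathematics):

* structure: `IsTeichLog.zero`, `.add`, `.neg`, `.padicInt_smul` (`a ∈ ℤ_p`), `.natCast_pow_mul` (`p^N`), `.add_mem_span` (`+ ξ^k B_dR⁺`),
  `isTeichLog_tBdR` (`t`), `isTeichLog_smul_tBdR` (`a·t`), `.galBdRPlus` (`Γ_F`-stability);
* ★ KERNEL `IsTeichLog.exists_pow_mul_sub_mul_tBdR_mem` (`θ L = 0 ⟹ p^N L − a·t ∈ ξ^k B_dR⁺`), ★ IMAGE `exists_isTeichLog_thetaBdR_eq_pow_mul`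
  (`p^N c = θ L`), `IsTeichLog.thetaBdR_eq_zero_of_mem_span` (`Fil^k ⊆ ker θ`, k ≥ 1).

So `X_k := ℚ_p · {L : IsTeichLog k L}` is Fontaine's `(B_crys⁺)^{φ=p} = ℚ_p·log[1+𝔪♭]` read modulo `Fil^k`, with its fundamental exact sequence, built
without `B_crys` or `φ`: floor (H4)-2 of `Summits/…/Cruxes/StarredOptimalManinUnitFiveSeven/Lines/kato-lever-K3-B2-road.md` (crux K★
`stmt-BirchSwinnertonDyer-22226`). Infrastructure only; BSD / K★ are not proved by any of this.

## References
* J.-M. Fontaine, Y. Ouyang, *Theory of p-adic Galois representations*, §6.1 (`U → B_crys^{φ=p}`, Thm. 6.26 the fundamental exact sequence). [FontaineOuyang2022]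
* J.-M. Fontaine, *Le corps des périodes p-adiques*, Astérisque 223 (1994), Exp. II §1.5.4. [FontaineAsterisque223III]
-/

noncomputable section

namespace Literature.NumberTheory.PAdicHodge

namespace GaloisContinuity

open ValuativeRel Field Ideal WittVector
open Literature.NumberTheory.GaloisRepresentations Literature.NumberTheory.GaloisRepresentations.IsNonarchimedeanLocalField

variable {F : Type} [Field F] [ValuativeRel F] [TopologicalSpace F] [IsNonarchimedeanLocalField F]
  [CharZero F] {p : ℕ} [Fact p.Prime] [Fact (¬ IsUnit (p : integerC F))]
  [IsAdicComplete (Ideal.span {(p : integerC F)}) (integerC F)]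

/-- **`L` is a Teichmüller logarithm modulo `Fil^k`**: `L ∈ B_dR⁺(F)` is a logarithm modulo `Fil^k B_dR⁺` (`IsLogModFil`) of `[x]` for some
`x ∈ 𝒪_{ℂ_F}♭` with `x₀ = 1` — the elements `log[x] mod Fil^k`, `x ∈ 1 + p♭𝒪♭`, generating Fontaine's `(B_crys⁺)^{φ=p}` modulo `Fil^k`.
[cite: FontaineOuyang2022, §6.1] -/
def IsTeichLog (k : ℕ) (L : BDeRhamPlus (integerC F) p) : Prop :=
  ∃ x : PreTilt (integerC F) p, PreTilt.coeff 0 x = 1 ∧ IsLogModFil k ((teichmuller p x : Ainf (p := p) F) - 1) L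

namespace IsTeichLog

omit [CharZero F] in
/-- `0 = log[1]`. [cite: FontaineOuyang2022, §6.1] -/
theorem zero (k : ℕ) : IsTeichLog (F := F) (p := p) k 0 :=
  ⟨1, by rw [map_one], by rw [map_one, sub_self]; exact isLogModFil_zero k⟩

/-- **Sums**: `log[x] + log[x'] = log[xx']`. [cite: FontaineOuyang2022, §6.1] -/
theorem add {k : ℕ} {L L' : BDeRhamPlus (integerC F) p} (hL : IsTeichLog k L) (hL' : IsTeichLog k L') : IsTeichLog k (L + L') := by
  obtain ⟨x, hx, h⟩ := hL
  obtain ⟨x', hx', h'⟩ := hL'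
  exact ⟨x * x', by rw [map_mul, hx, hx', mul_one], h.teichmuller_mul hx hx' h'⟩

/-- **`ℤ_p`-scalars**: `a · log[x] = log[x^a]`. [cite: FontaineOuyang2022, §6.1] -/
theorem padicInt_smul {k : ℕ} {L : BDeRhamPlus (integerC F) p} (hL : IsTeichLog k L) (a : ℤ_[p]) :
    IsTeichLog k (qpToBdR (a : ℚ_[p]) * L) := by
  obtain ⟨x, hx, h⟩ := hL
  exact ⟨PreTilt.tiltPow x a, PreTilt.coeff_zero_tiltPow x a, h.teichmuller_tiltPow hx a⟩

/-- Negatives: `−log[x] = log[x⁻¹]`. [cite: FontaineOuyang2022, §6.1] -/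
theorem neg {k : ℕ} {L : BDeRhamPlus (integerC F) p} (hL : IsTeichLog k L) : IsTeichLog k (-L) := by
  have h := hL.padicInt_smul (-1)
  rwa [PadicInt.coe_neg, PadicInt.coe_one, map_neg, map_one, neg_one_mul] at h

/-- Natural multiples, in particular `p^N · L`. [cite: FontaineOuyang2022, §6.1] -/
theorem natCast_mul {k : ℕ} {L : BDeRhamPlus (integerC F) p} (hL : IsTeichLog k L) (n : ℕ) :
    IsTeichLog k ((n : BDeRhamPlus (integerC F) p) * L) := by
  have h := hL.padicInt_smul n
  rwa [PadicInt.coe_natCast, map_natCast] at h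

omit [CharZero F] in
/-- Invariance modulo `Fil^k`: `IsTeichLog k` only depends on `L mod ξ^k B_dR⁺`. [cite: FontaineAsterisque223III, Exp. II §1.5.3] -/
theorem of_sub_mem {k : ℕ} {L L' : BDeRhamPlus (integerC F) p} (hL : IsTeichLog k L)
    (h : L' - L ∈ Ideal.span {(xiBdR : BDeRhamPlus (integerC F) p) ^ k}) : IsTeichLog k L' := by
  obtain ⟨x, hx, hx'⟩ := hL
  exact ⟨x, hx, hx'.of_sub_mem h⟩

/-- **`Γ_F`-stability**: `σ(log[x]) = log[σ♭ x]`. [cite: FontaineOuyang2022, §6.1] -/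
theorem galBdRPlus {k : ℕ} {L : BDeRhamPlus (integerC F) p} (hL : IsTeichLog k L) (σ : absoluteGaloisGroup F) :
    IsTeichLog k (galBdRPlus σ L) := by
  obtain ⟨x, hx, h⟩ := hL
  refine ⟨galTilt σ x, by rw [coeff_galTilt, hx, map_one], ?_⟩
  have h' := h.galBdRPlus σ
  rwa [map_sub, map_one, galAinf_teichmuller] at h'

end IsTeichLog

/-- **`t ∈ X⁰_k`**: Fontaine's `t` is the Teichmüller logarithm of `[ε]`. [cite: FontaineAsterisque223III, Exp. II §1.5.4] -/
theorem isTeichLog_tBdR (k : ℕ) : IsTeichLog (F := F) (p := p) k tBdR :=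
  ⟨eps, by rw [coeff_eps, epsC_zero, map_one], by rw [← uAinf_def]; exact isLogModFil_uAinf_tBdR k⟩

/-- `a · t ∈ X⁰_k` for `a ∈ ℤ_p` (`= log[ε^a]`). [cite: FontaineAsterisque223III, Exp. II §1.5.4] -/
theorem isTeichLog_smul_tBdR (k : ℕ) (a : ℤ_[p]) : IsTeichLog (F := F) (p := p) k (qpToBdR (a : ℚ_[p]) * tBdR) :=
  (isTeichLog_tBdR k).padicInt_smul a

/-- `Fil^k ⊆ ker θ` for `k ≥ 1`: `θ(ξ^k w) = 0`. [cite: FontaineAsterisque223III, Exp. II §1.5.2] -/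
theorem thetaBdR_eq_zero_of_mem_span_xiBdR_pow {k : ℕ} (hk : 1 ≤ k) {b : BDeRhamPlus (integerC F) p}
    (hb : b ∈ Ideal.span {(xiBdR : BDeRhamPlus (integerC F) p) ^ k}) : thetaBdR b = 0 := by
  obtain ⟨c, rfl⟩ := Ideal.mem_span_singleton'.1 hb
  obtain ⟨k', rfl⟩ := Nat.exists_eq_add_of_le hk
  rw [map_mul, map_pow, thetaBdR_xiBdR, zero_pow (by omega), mul_zero]

/-- ★ **KERNEL: `X_k ∩ ker θ = ℚ_p·t (mod Fil^k)`.** If `L ∈ X⁰_k` (`k ≥ 1`) has `θ(L) = 0` then `p^N·L − a·t ∈ ξ^k B_dR⁺` for some `N ∈ ℕ`,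
`a ∈ ℤ_p`. [cite: FontaineOuyang2022, §6.1] -/
theorem IsTeichLog.exists_pow_mul_sub_mul_tBdR_mem (hp : valuation F p < 1) {k : ℕ} (hk : 1 ≤ k) {L : BDeRhamPlus (integerC F) p}
    (hL : IsTeichLog k L) (h0 : thetaBdR L = 0) :
    ∃ (N : ℕ) (a : ℤ_[p]), (p : BDeRhamPlus (integerC F) p) ^ N * L - qpToBdR (a : ℚ_[p]) * tBdR ∈
      Ideal.span {(xiBdR : BDeRhamPlus (integerC F) p) ^ k} := by
  obtain ⟨x, hx, h⟩ := hL
  exact h.exists_pow_mul_sub_mul_tBdR_mem hp hk ((teichmuller_sub_one_mem_span_p_xi_iff_coeff_zero x).2 hx) h0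

/-- ★ **IMAGE: `θ(X_k) = ℂ_F`.** Every `c ∈ ℂ_F` is `p^{−N} θ(L)` for some `L ∈ X⁰_k` (`k ≥ 1`). [cite: FontaineOuyang2022, §6.1] -/
theorem exists_isTeichLog_thetaBdR_eq_pow_mul (hp : valuation F p < 1) {k : ℕ} (hk : 1 ≤ k) (c : CompletedAlgClosure F) :
    ∃ (N : ℕ) (L : BDeRhamPlus (integerC F) p), IsTeichLog k L ∧ thetaBdR L = (p : CompletedAlgClosure F) ^ N * c := by
  obtain ⟨N, x, L, hx, hL, hθ⟩ := exists_isLogModFil_thetaBdR_eq_pow_mul hp hk c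
  exact ⟨N, L, ⟨x, (teichmuller_sub_one_mem_span_p_xi_iff_coeff_zero x).1 hx, hL⟩, hθ⟩

/-- **Uniqueness of the Teichmüller logarithm of a given `[x]`** modulo `Fil^k`. [cite: FontaineAsterisque223III, Exp. II §1.5.3] -/
theorem IsLogModFil.teichmuller_unique {k : ℕ} {x : PreTilt (integerC F) p} {L L' : BDeRhamPlus (integerC F) p}
    (hL : IsLogModFil k ((teichmuller p x : Ainf (p := p) F) - 1) L) (hL' : IsLogModFil k ((teichmuller p x : Ainf (p := p) F) - 1) L') :
    L - L' ∈ Ideal.span {(xiBdR : BDeRhamPlus (integerC F) p) ^ k} :=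
  hL.sub_mem_span_xiBdR_pow hL'

/-- **`θ` of a Teichmüller logarithm is the `p`-adic logarithm of the untilt**: `HasSum (n ↦ −(1 − x♯)^{n+1}/(n+1)) (θ L)` for
`IsLogModFil k ([x] − 1) L`, `x₀ = 1`, `k ≥ 1`. [cite: FontaineOuyang2022, §6.1] -/
theorem IsLogModFil.hasSum_thetaBdR_teichmuller (hp : valuation F p < 1) {k : ℕ} (hk : 1 ≤ k) {x : PreTilt (integerC F) p}
    (hx : PreTilt.coeff 0 x = 1) {L : BDeRhamPlus (integerC F) p} (hL : IsLogModFil k ((teichmuller p x : Ainf (p := p) F) - 1) L) :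
    HasSum (fun n : ℕ => -((1 - ((PreTilt.untilt x : integerC F) : CompletedAlgClosure F)) ^ (n + 1)) / (n + 1 : CompletedAlgClosure F))
      (thetaBdR L) := by
  have h := hL.hasSum_thetaBdR hp hk ((teichmuller_sub_one_mem_span_p_xi_iff_coeff_zero x).2 hx)
  rwa [add_sub_cancel, thetaBdR_ainfToBdR_teichmuller] at h

end GaloisContinuity

end Literature.NumberTheory.PAdicHodge

end
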